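import Summits.KontsevichZagierPeriods.KontsevichZagierPeriods.Theorems.PentagonInKZ.Negative.LowWeight

/-!
# `PentagonInKZ` (stmt-KontsevichZagierPeriods-11348) — negative knowledge, part 8: tightness — the crux holds modulo weight 3

`pentAt_le_two`: for EVERY realisation `χ` of the rules and every agreeing assignment `Z`, the
pentagon identity for the crux series `Φ_χ` holds in the weight truncations `N ≤ 2`
UNCONDITIONALLY: the weight-`≤ 2` shape `c_∅ = 1`, `c_x = c_y = c_{xx} = c_{yy} = 0`,
`c_{yx} = -c_{xy}` comes from the shuffle regularisation (part 1), and at level 2 the pentagon for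
a series of that shape is the commutator identity
`[t₀₁,t₁₂+t₁₃] + [t₀₂+t₁₂,t₂₃] = [t₁₂,t₂₃] + [t₀₁+t₀₂,t₁₃+t₂₃] + [t₀₁,t₁₂]` in `U𝔞₄`, which
holds by locality alone (`pentAt_two_of_shape`).  So the first rung of any proof (or refutation)
of the crux is weight 3, where the content is `χ⟦ζ(3)⟧ = χ⟦ζ(2,1)⟧` (part 3).
[cite: Furusho2011, §2]
-/

noncomputable section

open Literature.NumberTheory.Transcendental

namespace Summit.KontsevichZagierPeriods.FurushoPentagon.PentagonInKZNegative

open Summit.KontsevichZagierPeriods.KontsevichZagierPeriods.Theses.FurushoPentagon (PentagonInKZ)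

/-! ## §15 Tightness: the crux HOLDS unconditionally modulo weight 3 (first rung = weight 3) -/

section LevelTwo

variable {k : Type} [CommRing k]

/-- **`φ(a, b) = 1 + c_{xy}(ab − ba)` in weight `≤ 2`** for a series of commutator shape in weight
`≤ 2` (`c_∅ = 1`, `c_x = c_y = c_{xx} = c_{yy} = 0`, `c_{yx} = -c_{xy}`). [folklore] -/
theorem evalTrunc_two_of_shape {φ : NCSeries Bool k} (hφ : φ [] = 1) (h0 : φ [false] = 0)
    (h1 : φ [true] = 0) (hff : φ [false, false] = 0) (htt : φ [true, true] = 0)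
    (htf : φ [true, false] = -φ [false, true]) {A : Type} [Ring A] [Algebra k A] (a b : A) :
    NCSeries.evalTrunc 2 (NCSeries.bsub a b) φ = 1 + φ [false, true] • (a * b - b * a) := by
  rw [NCSeries.evalTrunc_two_eq, Fintype.sum_bool, Fintype.sum_bool, Fintype.sum_bool,
    Fintype.sum_bool, hφ, h0, h1, hff, htt, htf]
  simp only [NCSeries.bsub_true, NCSeries.bsub_false, one_smul, zero_smul, add_zero, neg_smul,
    smul_sub]
  abel

local notation "𝔱₂" => (DrinfeldKohnoTrunc.t k 2 : Fin 4 → Fin 4 → DrinfeldKohnoTrunc k (Fin 4) 2)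

/-- Sums of generators are weight-one (level `2`). [folklore] -/
theorem t_mem_wFil_one (i j : Fin 4) :
    𝔱₂ i j ∈ (DrinfeldKohnoTrunc.wFil 1 : Submodule k (DrinfeldKohnoTrunc k (Fin 4) 2)) :=
  DrinfeldKohnoTrunc.mem_wFil_one_of_mem_genSpan (DrinfeldKohnoTrunc.t_mem_genSpan i j)

/-- Commutator combinations `c • (AB - BA)` of weight-one elements have weight two. [folklore] -/
theorem smul_comm_mem_wFil_two' (c : k) {A B : DrinfeldKohnoTrunc k (Fin 4) 2}
    (hA : A ∈ (DrinfeldKohnoTrunc.wFil 1 : Submodule k (DrinfeldKohnoTrunc k (Fin 4) 2)))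
    (hB : B ∈ (DrinfeldKohnoTrunc.wFil 1 : Submodule k (DrinfeldKohnoTrunc k (Fin 4) 2))) :
    c • (A * B - B * A) ∈ (DrinfeldKohnoTrunc.wFil 2 : Submodule k (DrinfeldKohnoTrunc k (Fin 4) 2)) :=
  Submodule.smul_mem _ _ (Submodule.sub_mem _ (NCSeries.mul_mem_wFil_two hA hB)
    (NCSeries.mul_mem_wFil_two hB hA))

/-- **The pentagon holds at level `2` for EVERY series of commutator shape in weight `≤ 2`**
(no pentagon hypothesis: `[t₀₁,t₂₃] = [t₀₂,t₁₃] = 0` by locality is all that is used).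
[cite: Furusho2011, §2] -/
theorem pentAt_two_of_shape {φ : NCSeries Bool k} (hφ : φ [] = 1) (h0 : φ [false] = 0)
    (h1 : φ [true] = 0) (hff : φ [false, false] = 0) (htt : φ [true, true] = 0)
    (htf : φ [true, false] = -φ [false, true]) : NCSeries.PentAt φ 2 := by
  dsimp only [NCSeries.PentAt, NCSeries.subst₂, NCSeries.t₄]
  rw [evalTrunc_two_of_shape hφ h0 h1 hff htt htf, evalTrunc_two_of_shape hφ h0 h1 hff htt htf,
    evalTrunc_two_of_shape hφ h0 h1 hff htt htf, evalTrunc_two_of_shape hφ h0 h1 hff htt htf,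
    evalTrunc_two_of_shape hφ h0 h1 hff htt htf]
  generalize φ [false, true] = c
  have h1m : ∀ i j : Fin 4, 𝔱₂ i j ∈ (DrinfeldKohnoTrunc.wFil 1 : Submodule k _) := t_mem_wFil_one
  have hadd : ∀ {A B : DrinfeldKohnoTrunc k (Fin 4) 2},
      A ∈ (DrinfeldKohnoTrunc.wFil 1 : Submodule k _) → B ∈ (DrinfeldKohnoTrunc.wFil 1 : Submodule k _) →
      A + B ∈ (DrinfeldKohnoTrunc.wFil 1 : Submodule k _) := fun hA hB => Submodule.add_mem _ hA hB
  -- the five commutator terms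
  have hK1 := smul_comm_mem_wFil_two' c (h1m 0 1) (hadd (h1m 1 2) (h1m 1 3))
  have hK2 := smul_comm_mem_wFil_two' c (hadd (h1m 0 2) (h1m 1 2)) (h1m 2 3)
  have hK3 := smul_comm_mem_wFil_two' c (h1m 1 2) (h1m 2 3)
  have hK4 := smul_comm_mem_wFil_two' c (hadd (h1m 0 1) (h1m 0 2)) (hadd (h1m 1 3) (h1m 2 3))
  have hK5 := smul_comm_mem_wFil_two' c (h1m 0 1) (h1m 1 2)
  have hz : ∀ {K K' : DrinfeldKohnoTrunc k (Fin 4) 2},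
      K ∈ (DrinfeldKohnoTrunc.wFil 2 : Submodule k _) → K' ∈ (DrinfeldKohnoTrunc.wFil 2 : Submodule k _) →
      K * K' = 0 := fun hK hK' => DrinfeldKohnoTrunc.mul_eq_zero_of_wFil (by omega) hK hK'
  generalize hK1e : c • (𝔱₂ 0 1 * (𝔱₂ 1 2 + 𝔱₂ 1 3) - (𝔱₂ 1 2 + 𝔱₂ 1 3) * 𝔱₂ 0 1) = K1 at hK1
  generalize hK2e : c • ((𝔱₂ 0 2 + 𝔱₂ 1 2) * 𝔱₂ 2 3 - 𝔱₂ 2 3 * (𝔱₂ 0 2 + 𝔱₂ 1 2)) = K2 at hK2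
  generalize hK3e : c • (𝔱₂ 1 2 * 𝔱₂ 2 3 - 𝔱₂ 2 3 * 𝔱₂ 1 2) = K3 at hK3
  generalize hK4e : c • ((𝔱₂ 0 1 + 𝔱₂ 0 2) * (𝔱₂ 1 3 + 𝔱₂ 2 3) - (𝔱₂ 1 3 + 𝔱₂ 2 3) * (𝔱₂ 0 1 + 𝔱₂ 0 2)) = K4 at hK4
  generalize hK5e : c • (𝔱₂ 0 1 * 𝔱₂ 1 2 - 𝔱₂ 1 2 * 𝔱₂ 0 1) = K5 at hK5
  have e1 : (1 + K1) * (1 + K2) = 1 + K1 + K2 := by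
    rw [mul_add, add_mul, one_mul, mul_one, add_mul, one_mul, hz hK1 hK2, add_zero]
  have e2 : (1 + K3) * (1 + K4) * (1 + K5) = 1 + K3 + K4 + K5 := by
    have : (1 + K3) * (1 + K4) = 1 + K3 + K4 := by
      rw [mul_add, add_mul, one_mul, mul_one, add_mul, one_mul, hz hK3 hK4, add_zero]
    rw [this, mul_add, mul_one, add_mul, add_mul, one_mul, hz hK3 hK5, hz hK4 hK5, add_zero,
      add_zero]
  rw [e1, e2, ← hK1e, ← hK2e, ← hK3e, ← hK4e, ← hK5e, add_assoc, add_assoc, add_assoc, ← smul_add,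
    ← smul_add, ← smul_add]
  congr 2
  -- the commutator identity: difference is [t₀₁,t₂₃] + [t₀₂,t₁₃] = 0 by locality
  have l1 : 𝔱₂ 0 1 * 𝔱₂ 2 3 = 𝔱₂ 2 3 * 𝔱₂ 0 1 :=
    DrinfeldKohnoTrunc.t_comm 0 1 2 3 (by decide) (by decide) (by decide) (by decide) (by decide)
      (by decide)
  have l2 : 𝔱₂ 0 2 * 𝔱₂ 1 3 = 𝔱₂ 1 3 * 𝔱₂ 0 2 :=
    DrinfeldKohnoTrunc.t_comm 0 2 1 3 (by decide) (by decide) (by decide) (by decide) (by decide)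
      (by decide)
  have key : 𝔱₂ 0 1 * (𝔱₂ 1 2 + 𝔱₂ 1 3) - (𝔱₂ 1 2 + 𝔱₂ 1 3) * 𝔱₂ 0 1 +
      ((𝔱₂ 0 2 + 𝔱₂ 1 2) * 𝔱₂ 2 3 - 𝔱₂ 2 3 * (𝔱₂ 0 2 + 𝔱₂ 1 2)) -
      (𝔱₂ 1 2 * 𝔱₂ 2 3 - 𝔱₂ 2 3 * 𝔱₂ 1 2 +
        ((𝔱₂ 0 1 + 𝔱₂ 0 2) * (𝔱₂ 1 3 + 𝔱₂ 2 3) - (𝔱₂ 1 3 + 𝔱₂ 2 3) * (𝔱₂ 0 1 + 𝔱₂ 0 2) +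
          (𝔱₂ 0 1 * 𝔱₂ 1 2 - 𝔱₂ 1 2 * 𝔱₂ 0 1))) =
      -(𝔱₂ 0 1 * 𝔱₂ 2 3 - 𝔱₂ 2 3 * 𝔱₂ 0 1) - (𝔱₂ 0 2 * 𝔱₂ 1 3 - 𝔱₂ 1 3 * 𝔱₂ 0 2) := by
    noncomm_ring
  rw [l1, l2, sub_self, sub_self, neg_zero, sub_zero, sub_eq_zero] at key
  exact key

end LevelTwo

/-- **The crux holds unconditionally modulo weight 3**: for EVERY realisation `χ` and agreeing
`Z`, the pentagon identity for `Φ_χ` holds in the truncations `N ≤ 2` (weight `≤ 2` shape by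
regularisation; level `2` by locality alone).  So the first rung of any proof or refutation is
weight 3 (= `χ⟦ζ(3)⟧ = χ⟦ζ(2,1)⟧`, §5). [cite: Furusho2011, §2] -/
theorem pentAt_le_two {R : Type} [CommRing R] [Algebra ℚ R] {χ : KZ.FormalRep →+ R}
    (hχ : IsRealisation R χ) {Z : List ℕ → KZ.FormalRep} (hZ : AgreesWithSimplex Z) :
    ∀ N ≤ 2, NCSeries.PentAt (cruxSeries R χ Z) N := by
  intro N hN
  have h0 := cruxSeries_nil_eq_one χ Z hχ hZ
  obtain rfl | rfl | rfl : N = 0 ∨ N = 1 ∨ N = 2 := by omega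
  · change _ * _ = _ * _ * _
    rw [NCSeries.subst₂, NCSeries.subst₂, NCSeries.subst₂, NCSeries.subst₂, NCSeries.subst₂,
      NCSeries.evalTrunc_zero_eq_one h0, NCSeries.evalTrunc_zero_eq_one h0,
      NCSeries.evalTrunc_zero_eq_one h0, NCSeries.evalTrunc_zero_eq_one h0,
      NCSeries.evalTrunc_zero_eq_one h0, mul_one, mul_one]
  · change _ * _ = _ * _ * _
    rw [NCSeries.subst₂, NCSeries.subst₂, NCSeries.subst₂, NCSeries.subst₂, NCSeries.subst₂,
      NCSeries.evalTrunc_one_eq_one h0 (cruxSeries_x χ Z) (cruxSeries_y χ Z),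
      NCSeries.evalTrunc_one_eq_one h0 (cruxSeries_x χ Z) (cruxSeries_y χ Z),
      NCSeries.evalTrunc_one_eq_one h0 (cruxSeries_x χ Z) (cruxSeries_y χ Z),
      NCSeries.evalTrunc_one_eq_one h0 (cruxSeries_x χ Z) (cruxSeries_y χ Z),
      NCSeries.evalTrunc_one_eq_one h0 (cruxSeries_x χ Z) (cruxSeries_y χ Z), mul_one, mul_one]
  · exact pentAt_two_of_shape h0 (cruxSeries_x χ Z) (cruxSeries_y χ Z)
      (cruxSeries_xx χ Z) (cruxSeries_yy χ Z) (by rw [cruxSeries_yx, cruxSeries_xy, neg_neg])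


end Summit.KontsevichZagierPeriods.FurushoPentagon.PentagonInKZNegative
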